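import Literature.AnabelianGeometry.SemiGraphs.FundamentalGroup
import Literature.GroupTheory.CombinatorialGroupTheory.FreeGroupoidWords
import HarnessLib

/-!
# Immersions of semi-graphs are injective on fundamental groups ([SemiAnbd] §1, Cor. 1.6)

Mochizuki, *Semi-graphs of anabelioids*, Publ. RIMS **42** (2006), §1: the proof of Cor. 1.6 (i)
(A. Tamagawa) uses an immersion of finite graphs `G_A → G_B` whose induced morphism on
(topological) fundamental groups "is isomorphic to the inclusion `F ↪ G`" — in particular is
injective.  In L3-t1's model (`FundamentalGroup.lean`: `π₁(𝔾, c)` = vertex group of Mathlib's free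
groupoid on the quiver `catQuiver 𝔾`, one arrow `e → v` per abutting branch) this is Stallings'
observation (*Topology of finite graphs*, Invent. Math. 71 (1983), Prop. 5.3) that an immersion maps
reduced zigzag paths to reduced zigzag paths, combined with the uniqueness of reduced
representatives (`FreeGroupoidWords.lean`, Stallings Prop. 5.2).  Contents:

* `mapFundamentalGroupoid_map_homMk` — the induced functor sends the class of a zigzag path to the
  class of its image path;
* `arrowBranch` bookkeeping: an arrow of `catQuiver 𝔾` is determined by its branch;
* `IsImmersion.isReduced_mapPath` — immersions preserve reducedness of zigzag paths;
* `IsImmersion.mapFundamentalGroup_injective` — immersions are injective on `π₁`.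

Proof-only companion (no new definitions beyond the auxiliary `arrowBranch`).
-/

namespace Literature.AnabelianGeometry.SemiGraphs

namespace SemiGraph

open CategoryTheory Quiver
open Literature.GroupTheory.CombinatorialGroupTheory
open Literature.GroupTheory.CombinatorialGroupTheory.FreeGroupoidWords

universe u

variable {G G' : SemiGraph.{u}}

/-! ### The induced functor on classes of zigzag paths -/

/-- On objects the induced functor is the map of components. [cite: MochizukiSemiAnbd2006, Cor. 1.6(i) p.19] -/
theorem mapFundamentalGroupoid_obj (φ : G ⟶ G') (X : G.CatCarrier) :
    (Hom.mapFundamentalGroupoid φ).obj (FreeGroupoidWords.obj X) =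
      FreeGroupoidWords.obj (V := G'.CatCarrier) ((Hom.catPrefunctor φ).obj X) := rfl

/-- The induced functor on the class of one formal arrow. [cite: MochizukiSemiAnbd2006, Cor. 1.6(i) p.19] -/
theorem mapFundamentalGroupoid_map_homMk_toPath (φ : G ⟶ G') {X Y : Symmetrify G.CatCarrier}
    (f : X ⟶ Y) :
    (Hom.mapFundamentalGroupoid φ).map (homMk f.toPath) =
      homMk ((Hom.catPrefunctor φ).symmetrify.map f).toPath := by
  change (Paths.lift (Symmetrify.lift _)).map f.toPath = _
  rw [Paths.lift_toPath]
  cases f with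
  | inl e => rfl
  | inr e => rfl

/-- **The induced functor sends the class of a zigzag path to the class of its image path.**
[cite: MochizukiSemiAnbd2006, Cor. 1.6(i) p.19] -/
theorem mapFundamentalGroupoid_map_homMk (φ : G ⟶ G') {X : Symmetrify G.CatCarrier} :
    ∀ {Y : Symmetrify G.CatCarrier} (p : Path X Y),
      (Hom.mapFundamentalGroupoid φ).map (homMk p) =
        homMk ((Hom.catPrefunctor φ).symmetrify.mapPath p)
  | _, Path.nil => by
    change (Hom.mapFundamentalGroupoid φ).map (𝟙 _) =
      homMk (V := G'.CatCarrier) (Path.nil : Path ((Hom.catPrefunctor φ).symmetrify.obj X) _)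
    exact (CategoryTheory.Functor.map_id _ _).trans (homMk_nil (V := G'.CatCarrier) _).symm
  | _, Path.cons p f => by
    change (Hom.mapFundamentalGroupoid φ).map (homMk p ≫ homMk f.toPath) =
      homMk (V := G'.CatCarrier) (((Hom.catPrefunctor φ).symmetrify.mapPath p).cons
        ((Hom.catPrefunctor φ).symmetrify.map f))
    rw [CategoryTheory.Functor.map_comp, mapFundamentalGroupoid_map_homMk φ p,
      mapFundamentalGroupoid_map_homMk_toPath, homMk_cons]
    rfl

/-! ### Arrows of `Cat(𝔾)` are branches -/

/-- The branch underlying an arrow of `catQuiver 𝔾` (every arrow is `e → v` for a branch of `e`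
abutting to `v`). [cite: MochizukiSemiAnbd2006, Def. 2.11 p.32] -/
def arrowBranch : Letter G.CatCarrier → G.Branch
  | ⟨Sum.inr _, Sum.inl _, x⟩ => x.1
  | ⟨Sum.inl _, Sum.inl _, x⟩ => PEmpty.elim x
  | ⟨Sum.inl _, Sum.inr _, x⟩ => PEmpty.elim x
  | ⟨Sum.inr _, Sum.inr _, x⟩ => PEmpty.elim x

/-- An arrow goes from its edge to the vertex its branch abuts to.
[cite: MochizukiSemiAnbd2006, Def. 2.11 p.32] -/
theorem arrowBranch_spec (l : Letter G.CatCarrier) :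
    l.1 = Sum.inr (G.edgeOf (arrowBranch l)) ∧
      ∃ v : G.Vertex, l.2.1 = Sum.inl v ∧ G.abuts (arrowBranch l) = some v := by
  obtain ⟨a, c, x⟩ := l
  rcases a with v | e <;> rcases c with w | e'
  · exact PEmpty.elim x
  · exact PEmpty.elim x
  · exact ⟨congrArg Sum.inr x.2.1.symm, w, rfl, x.2.2⟩
  · exact PEmpty.elim x

/-- An arrow is determined by its branch. [cite: MochizukiSemiAnbd2006, Def. 2.11 p.32] -/
theorem arrowBranch_injective : Function.Injective (arrowBranch (G := G)) := by
  rintro ⟨a, c, x⟩ ⟨a', c', x'⟩ h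
  rcases a with v | e <;> rcases c with w | f
  · exact PEmpty.elim x
  · exact PEmpty.elim x
  swap
  · exact PEmpty.elim x
  rcases a' with v' | e' <;> rcases c' with w' | f'
  · exact PEmpty.elim x'
  · exact PEmpty.elim x'
  swap
  · exact PEmpty.elim x'
  change x.1 = x'.1 at h
  obtain ⟨b, hbe, hbw⟩ := x
  obtain ⟨b', hbe', hbw'⟩ := x'
  simp only at h
  subst h
  obtain rfl : e = e' := hbe.symm.trans hbe'
  obtain rfl : w = w' := Option.some_injective _ (hbw.symm.trans hbw')
  rfl

/-- The branch of the image arrow is the image branch. [cite: MochizukiSemiAnbd2006, §1 p.11] -/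
theorem arrowBranch_letter_symmetrify (φ : G ⟶ G') {X Y : Symmetrify G.CatCarrier} (f : X ⟶ Y) :
    arrowBranch (letter ((Hom.catPrefunctor φ).symmetrify.map f)).1 =
      φ.branchMap (arrowBranch (letter f).1) := by
  rcases f with x | x
  · obtain ⟨a, c⟩ := (⟨X, Y⟩ : Symmetrify G.CatCarrier × Symmetrify G.CatCarrier)
    rcases X with v | e <;> rcases Y with w | e'
    · exact PEmpty.elim x
    · exact PEmpty.elim x
    · rfl
    · exact PEmpty.elim x
  · rcases X with v | e <;> rcases Y with w | e'
    · exact PEmpty.elim x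
    · rfl
    · exact PEmpty.elim x
    · exact PEmpty.elim x

/-- The sign of the image arrow is the sign of the arrow. [cite: MochizukiSemiAnbd2006, §1 p.11] -/
theorem letter_symmetrify_snd (φ : G ⟶ G') {X Y : Symmetrify G.CatCarrier} (f : X ⟶ Y) :
    (letter ((Hom.catPrefunctor φ).symmetrify.map f)).2 = (letter f).2 := by
  rcases f with x | x <;> rfl

/-- A forward arrow `f : X ⟶ Y` has letter with source `X` and target `Y`.
[cite: Stallings1983, §2.1 p.553] -/
theorem letter_fst_of_snd_true {X Y : Symmetrify G.CatCarrier} (f : X ⟶ Y)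
    (h : (letter f).2 = true) : (letter f).1.1 = X ∧ (letter f).1.2.1 = Y := by
  rcases f with x | x
  · exact ⟨rfl, rfl⟩
  · simp [letter] at h

/-- A backward arrow `f : X ⟶ Y` has letter with source `Y` and target `X`.
[cite: Stallings1983, §2.1 p.553] -/
theorem letter_fst_of_snd_false {X Y : Symmetrify G.CatCarrier} (f : X ⟶ Y)
    (h : (letter f).2 = false) : (letter f).1.1 = Y ∧ (letter f).1.2.1 = X := by
  rcases f with x | x
  · simp [letter] at h
  · exact ⟨rfl, rfl⟩

/-! ### Immersions preserve reducedness -/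

/-- The geometric heart: two consecutive formal arrows of OPPOSITE signs whose images under an
immersion have the same underlying arrow already have the same underlying arrow (they share a
vertex-object, where the immersion is injective on abutting branches, or an edge-object, where any
morphism is injective on branches). [cite: MochizukiSemiAnbd2006, Cor. 1.6(i) p.19] -/
theorem letter_fst_eq_of_isImmersion {φ : G ⟶ G'} (hφ : IsImmersion φ)
    {X Y Z : Symmetrify G.CatCarrier} (f : X ⟶ Y) (g : Y ⟶ Z)
    (hs : (letter g).2 ≠ (letter f).2)
    (heq : (letter ((Hom.catPrefunctor φ).symmetrify.map g)).1 =
      (letter ((Hom.catPrefunctor φ).symmetrify.map f)).1) :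
    (letter g).1 = (letter f).1 := by
  have hb : φ.branchMap (arrowBranch (letter g).1) = φ.branchMap (arrowBranch (letter f).1) := by
    rw [← arrowBranch_letter_symmetrify, ← arrowBranch_letter_symmetrify, heq]
  apply arrowBranch_injective
  obtain ⟨hfe, vf, hfv, hfa⟩ := arrowBranch_spec (letter f).1
  obtain ⟨hge, vg, hgv, hga⟩ := arrowBranch_spec (letter g).1
  cases hf2 : (letter f).2 with
  | true =>
    -- `f` forward: `f : inr e ⟶ inl v`, so `g` is backward out of the vertex-object `Y = inl v`
    have hg2 : (letter g).2 = false := by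
      cases h : (letter g).2
      · rfl
      · exact absurd (h.trans hf2.symm) hs
    obtain ⟨-, hfY⟩ := letter_fst_of_snd_true f hf2
    obtain ⟨-, hgY⟩ := letter_fst_of_snd_false g hg2
    -- both branches abut to the vertex `v` with `Y = inl v`
    have hv : vf = vg := Sum.inl_injective ((hfv.symm.trans hfY).trans (hgY.symm.trans hgv))
    subst hv
    have := hφ vf (a₁ := ⟨_, hga⟩) (a₂ := ⟨_, hfa⟩) (Subtype.ext hb)
    exact congrArg Subtype.val this
  | false =>
    -- `f` backward: `f : inl v ⟶ inr e`, so `g` is forward out of the edge-object `Y = inr e`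
    have hg2 : (letter g).2 = true := by
      cases h : (letter g).2
      · exact absurd (h.trans hf2.symm) hs
      · rfl
    obtain ⟨hfY, -⟩ := letter_fst_of_snd_false f hf2
    obtain ⟨hgY, -⟩ := letter_fst_of_snd_true g hg2
    have he : G.edgeOf (arrowBranch (letter g).1) = G.edgeOf (arrowBranch (letter f).1) :=
      Sum.inr_injective ((hge.symm.trans hgY).trans (hfY.symm.trans hfe))
    exact φ.branchMap_injOn _ _ he hb

/-- **Immersions preserve reducedness** (Stallings Prop. 5.3, first half): the image of a reduced
zigzag path under an immersion is reduced. [cite: MochizukiSemiAnbd2006, Cor. 1.6(i) p.19] -/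
theorem IsImmersion.isReduced_mapPath {φ : G ⟶ G'} (hφ : IsImmersion φ)
    {X : Symmetrify G.CatCarrier} :
    ∀ {Y : Symmetrify G.CatCarrier} (p : Path X Y),
      FreeGroupoidWords.IsReduced p →
        FreeGroupoidWords.IsReduced ((Hom.catPrefunctor φ).symmetrify.mapPath p)
  | _, Path.nil, _ => by rw [Prefunctor.mapPath_nil]; exact IsReduced.nil _
  | _, Path.cons Path.nil f, _ => by
    rw [Prefunctor.mapPath_cons, Prefunctor.mapPath_nil]
    exact IsReduced.toPath _
  | _, Path.cons (Path.cons p f) g, h => by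
    rw [Prefunctor.mapPath_cons, Prefunctor.mapPath_cons, isReduced_cons_cons_iff]
    rw [isReduced_cons_cons_iff] at h
    refine ⟨fun heq => ?_, ?_⟩
    · rw [letter_symmetrify_snd, letter_symmetrify_snd]
      by_contra hs
      exact hs (h.1 (letter_fst_eq_of_isImmersion hφ f g hs heq))
    · have := IsImmersion.isReduced_mapPath hφ (p.cons f) h.2
      rwa [Prefunctor.mapPath_cons] at this

/-- The image path has the same length. [cite: Stallings1983, §2.1 p.553] -/
theorem length_mapPath_symmetrify (φ : G ⟶ G') {X : Symmetrify G.CatCarrier} :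
    ∀ {Y : Symmetrify G.CatCarrier} (p : Path X Y),
      ((Hom.catPrefunctor φ).symmetrify.mapPath p).length = p.length
  | _, Path.nil => rfl
  | _, Path.cons p f => by
    rw [Prefunctor.mapPath_cons, Path.length_cons, Path.length_cons, length_mapPath_symmetrify φ p]

/-- **Immersions are injective on fundamental groups** (Stallings Prop. 5.3; used in [SemiAnbd]
Cor. 1.6 (i)): for an immersion `φ : 𝔾 → 𝔾'` and any component `c`, the induced homomorphism
`π₁(𝔾, c) → π₁(𝔾', φ c)` is injective. [cite: MochizukiSemiAnbd2006, Cor. 1.6(i) p.19] -/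
theorem IsImmersion.mapFundamentalGroup_injective {φ : G ⟶ G'} (hφ : IsImmersion φ)
    (c : G.CatCarrier) : Function.Injective (Hom.mapFundamentalGroup φ c) := by
  rw [injective_iff_map_eq_one]
  intro x hx
  obtain ⟨r, hr, rfl⟩ := exists_isReduced_homMk_eq (V := G.CatCarrier) (X := c) (Y := c) x
  change (Hom.mapFundamentalGroupoid φ).map (homMk r) = 𝟙 _ at hx
  rw [mapFundamentalGroupoid_map_homMk] at hx
  have hnil := (homMk_eq_id_iff _ (hφ.isReduced_mapPath r hr)).mp hx
  have hlen : r.length = 0 := by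
    rw [← length_mapPath_symmetrify φ r, hnil, Path.length_nil]
  rw [Path.eq_nil_of_length_zero r hlen, homMk_nil]
  rfl

end SemiGraph

end Literature.AnabelianGeometry.SemiGraphs
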